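import Summits.Ventures.CertifiedArithmetic.LowPrec.GemmFirstRegimeWindow
import HarnessLib

/-!
# GEMM worst case LXIX-e — THE WINDOW past the first regime, part 5: the rows for E2M1·E2M1
# products in every precision `p ≥ 10` and in binary32

HONEST FRAMING: certified error envelopes and provably optimal rounding/accumulation schemes for
low-precision formats under stated cost models; every table by two implementations; no hardware or
vendor claims.

E2M1·E2M1 products (`G = 2`, `M = 144`, `m₀ = 9`), accumulator of precision `p = manBits + 1`,
`T = 2^p` quarter units, `144 j₀ + 9 < T` (exact prefix `n₀ = j₀ + 1` letters).
* `worstP_le_window` (every `p ≥ 10`, every word): `W_p(j₀+1+d) ≤ (d+1)/(T+d+1)` for every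
  `d + 1 ≤ T/2 + 4` — the window law of file LXIX-d with the trivial entry mass `B = T`
  (`entryMass_T`: a prefix sum above `T` has mass above `T`); `Q = 2T - 144(j₀+2) ≥ 581` is
  automatic from `T ≥ 1024`.
* `worstP_window` (`p ≡ 0, 3, 4, 5 (mod 6)`, i.e. `T + 1 = A + B + 144 j₀` over letters):
  `W_p(j₀ + k) = k/(T+k)` for EVERY `1 ≤ k ≤ 2^(p-1) + 4` — the first-regime law of file XLIX-b
  (`worstP_firstRegime`, `k ≤ 2^(p-1)`) FOUR STEPS FURTHER; the lower family is the entry word of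
  file XLIX-b (`le_worstP_firstRegime`, every `k`).  It stops there: for `k ≥ 2^(p-1) + 5` the
  level-`2T` family of file LXVIII is strictly larger (`firstRegime_fails_five`).
* binary32 (`p = 24`): `worstP_Binary32_window`, `W_24(116509 + k) = k/(2^24 + k)` for every
  `1 ≤ k ≤ 2^23 + 4` (`n ≤ 8505121`; file XLIX-b had `k ≤ 2^23`, file LXVIII the failure from
  `k = 2^23 + 5` on): the binary32 row of GEMM-BOUNDS.md §4 is now decided for every `n`
  up to `8505121` and the first-regime value is known to fail from `8505122` on.
For `p ≡ 1, 2 (mod 6)` only the upper bound `k/(T+k)` is recorded here (the exact window values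
involve the entry mass `B = T + 16`, `T + 32` and are not treated).  binary16 (`n ≤ 1043`) needs
the range transfer of file LXV and is file LXIX-f.

References: [Higham2002, §4.2], [IEEE7542019, §4.3.1], [LangeRump2019], [BoldoEtAl2023, Thm 4.5].
-/

namespace Summit.Ventures.CertifiedArithmetic.LowPrec.Gemm

open Literature.ComputerArithmetic.FloatingPoint
open Literature.ComputerArithmetic.FloatingPoint.MiniFloat
open Finset

/-! ### The trivial entry mass `B = T` -/

/-- For every grid word, a prefix whose sum exceeds `T` in modulus has mass at least `(T+1)/2^G`:
the entry-mass hypothesis `H_B` of files LXIII/LXIV/LXIX holds with `B = T` for every alphabet.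
[cell] -/
theorem entryMass_T {G M m0 : ℕ} {x : ℕ → ℚ}
    (hx : ∀ j, ∃ z : ℤ, x j = (z : ℚ) / 2 ^ G ∧ z.natAbs ≤ M ∧ (z % 2 = 0 ∨ z.natAbs ≤ m0))
    {n T : ℕ} (hbig : T < (∑ i ∈ range n, zl G x i).natAbs) :
    ((T : ℚ) + 1) / 2 ^ G ≤ ∑ i ∈ range n, |x i| := by
  rw [sum_abs_eq_natG hx n]
  apply div_le_div_of_nonneg_right _ (by positivity)
  have h1 : (∑ i ∈ range n, zl G x i).natAbs ≤ ∑ i ∈ range n, (zl G x i).natAbs :=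
    Int.natAbs_sum_le _ _
  have h2 : T + 1 ≤ ∑ i ∈ range n, (zl G x i).natAbs := by omega
  exact_mod_cast h2

/-! ### E2M1·E2M1 products, every precision `p ≥ 10` -/

section E2M1Window

variable {φ : Format} (hm : 9 ≤ φ.manBits) (hq : φ.qexp ≤ -2)
  (hR : (2 : ℚ) ^ (φ.manBits + 10) ≤ φ.maxRat)
include hm hq hR

/-- UPPER HALF for E2M1², every precision `p ≥ 10`, through the window `k = d + 1 ≤ 2^(p-1) + 4`:
with `144 j₀ + 9 < T`, `W_φ(j₀+1+d) ≤ (d+1)/(T+d+1)` for EVERY word. [cell, gemm.tex Prop. p:fpW] -/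
theorem worstP_le_window {j0 d : ℕ} (hj0 : 144 * j0 + 9 < 2 ^ (φ.manBits + 1))
    (hd : d + 1 ≤ 2 ^ φ.manBits + 4) :
    worstRelErrE2M1 φ (j0 + 1 + d) ≤ ((d : ℚ) + 1) / (2 ^ (φ.manBits + 1) + ((d : ℚ) + 1)) := by
  have hT10 : 1024 ≤ 2 ^ (φ.manBits + 1) :=
    le_trans (by norm_num) (Nat.pow_le_pow_right (by norm_num) (by omega : 10 ≤ φ.manBits + 1))
  obtain ⟨Q, hQ⟩ : ∃ Q, 144 * (j0 + 2) + Q = 2 * 2 ^ (φ.manBits + 1) :=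
    ⟨2 * 2 ^ (φ.manBits + 1) - 144 * (j0 + 2), by omega⟩
  have h := gridW_le_window_all (L := fun q => q ∈ piE2M1) piE2M1_grid (worstP_specE φ).2 hq
    (E := 7) hR (by norm_num) (le_trans (by norm_num) hT10) (by norm_num) (by norm_num)
    (Bn := 2 ^ (φ.manBits + 1)) (by omega) hj0
    (fun x hx _ hbig => entryMass_T (fun j => piE2M1_grid _ (hx j)) hbig) hQ (by omega) hd
  push_cast at h
  rwa [max_self] at h

/-- THE FIRST-REGIME LAW THROUGH THE WINDOW for `p ≡ 0, 3, 4, 5 (mod 6)`, `p ≥ 10`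
(`T + 1 = A + B + 144 j₀` over letters, `144 j₀ + 9 < T`): `W_φ(j₀ + k) = k/(T + k) = ku/(1+ku)`
for EVERY `1 ≤ k ≤ 2^(p-1) + 4` — four steps beyond `worstP_firstRegime`; from `k = 2^(p-1) + 5`
on it fails (`firstRegime_fails_five`, file LXVIII). [cell, gemm.tex Prop. p:fpW] -/
theorem worstP_window {j0 A B : ℕ} (hA : ((A : ℕ) : ℚ) / 4 ∈ piE2M1)
    (hB : ((B : ℕ) : ℚ) / 4 ∈ piE2M1) (hj0 : 144 * j0 + 9 < 2 ^ (φ.manBits + 1))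
    (hAB : A + B + 144 * j0 = 2 ^ (φ.manBits + 1) + 1) {k : ℕ} (hk : 1 ≤ k)
    (hk' : k ≤ 2 ^ φ.manBits + 4) :
    worstRelErrE2M1 φ (j0 + k) = (k : ℚ) / (2 ^ (φ.manBits + 1) + k) := by
  obtain ⟨d, rfl⟩ : ∃ d, k = d + 1 := ⟨k - 1, by omega⟩
  have hup := worstP_le_window hm hq hR hj0 hk'
  rw [show j0 + 1 + d = j0 + (d + 1) by ring] at hup
  have hlo := le_worstP_firstRegime (by omega) hq hR hA hB (by omega) hAB hk
  push_cast at hlo ⊢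
  exact le_antisymm hup hlo

end E2M1Window

/-! ### binary32 (`p = 24`): `T = 2^24 = 144·116508 + 64`, `n₀ = 116509`, letters `(16, ¼)` -/

/-- THE EXACT WORST CASE OF FP4 PRODUCTS ACCUMULATED IN binary32 THROUGH THE WINDOW,
`116510 ≤ n ≤ 8505121`: `W_24(116509 + k) = k/(2^24 + k)` for every `1 ≤ k ≤ 2^23 + 4` (index
`m = 116508 + k`; the four lengths `n = 8505118 … 8505121` are new), attained by
`16, ¼, 36^{×116508}, ¼^{×(k-1)}`; false from `k = 2^23 + 5` on (`worstP_Binary32_law_fails`).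
[cell, gemm.tex Prop. p:fpW] -/
theorem worstP_Binary32_window {k : ℕ} (hk : 1 ≤ k) (hk' : k ≤ 2 ^ 23 + 4) :
    worstRelErrE2M1 Format.Binary32 (116508 + k) = (k : ℚ) / (2 ^ 24 + k) := by
  obtain ⟨-, h2, h3, -⟩ := Binary32_hyps
  have hmb : Format.Binary32.manBits = 23 := rfl
  have h := worstP_window (φ := Format.Binary32) (by rw [hmb]; norm_num) h2 h3 (j0 := 116508)
    (A := 64) (B := 1) (by norm_num [piE2M1]) (by norm_num [piE2M1]) (by rw [hmb]; norm_num)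
    (by rw [hmb]; norm_num) hk (by rw [hmb]; omega)
  rw [h, hmb]

/-- The four new binary32 values: `W_24(8505118) = 8388609/25165825`, `W_24(8505119) =
4194305/12582913`, `W_24(8505120) = 8388611/25165827`, `W_24(8505121) = 2097153/6291457`
(indices `n - 1`). [cell, gemm.tex Prop. p:fpW] -/
theorem worstP_Binary32_window_values :
    worstRelErrE2M1 Format.Binary32 8505117 = 8388609 / 25165825 ∧
    worstRelErrE2M1 Format.Binary32 8505118 = 4194305 / 12582913 ∧
    worstRelErrE2M1 Format.Binary32 8505119 = 8388611 / 25165827 ∧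
    worstRelErrE2M1 Format.Binary32 8505120 = 2097153 / 6291457 := by
  refine ⟨?_, ?_, ?_, ?_⟩
  · rw [show (8505117 : ℕ) = 116508 + 8388609 from rfl,
      worstP_Binary32_window (by norm_num) (by norm_num)]; norm_num
  · rw [show (8505118 : ℕ) = 116508 + 8388610 from rfl,
      worstP_Binary32_window (by norm_num) (by norm_num)]; norm_num
  · rw [show (8505119 : ℕ) = 116508 + 8388611 from rfl,
      worstP_Binary32_window (by norm_num) (by norm_num)]; norm_num
  · rw [show (8505120 : ℕ) = 116508 + 8388612 from rfl,
      worstP_Binary32_window (by norm_num) (by norm_num)]; norm_num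

end Summit.Ventures.CertifiedArithmetic.LowPrec.Gemm
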